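import Summits.NavierStokesRegularity.FluidComputer.SpectralFront
import Summits.NavierStokesRegularity.FluidComputer.SobolevLadderSerrin
import Summits.NavierStokesRegularity.FluidComputer.SobolevLadderProduct
import HarnessLib

/-!
# Fluid computer — the SOBOLEV LADDER in `Ḣ^s` currency, assembled (the `Ḣ^s` FACE) and read on the cell's interface

HONEST FRAMING (cell `pub-fluidc`, verbatim): *low prior, high value-of-information experiment on Tao's
machine paradigm; NOT a claim that NS blows up.* Theorem side of the cell; nothing here is evidence of blow-up.

One statement per Sobolev index `s ∈ (1/2, 3/2)` out of `HomSobolevLadder` (L52), `SobolevLadderSerrin` (L52-S),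
`SobolevLadderProduct` (L52-P) and `SpectralFront` (L52″–L52⁗), in the shape of the earlier assembled faces:

* `homSobolev_face` — for every `s ∈ (1/2, 3/2)` there are constants `c, c', c'' > 0` such that along every maximal
  smooth Leray–Hopf solution of the unforced Navier–Stokes system on `ℝ³` (`ν > 0`): (C) the `Ḣ^s` clock
  `c ν^{(5−2s)/4} (T − t)^{−(2s−1)/4} ≤ ‖u(t)‖_{Ḣ^s}` at every `t ∈ (0, T)`; (D) `‖u(t)‖_{Ḣ^s} → ∞` as `t ↑ T`;
  (S) the Sobolev–Serrin integral `∫_{(t₀,T)} ‖u‖_{Ḣ^s}^{4/(2s−1)} = ∞` on every terminal window, with the log floor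
  `c' ν^{(5−2s)/(2s−1)} log((T − t₀)/(T − t)) ≤ ∫_{(t₀,t)} ‖u‖_{Ḣ^s}^{4/(2s−1)}`; (P) the scale-invariant product
  `c'' ν^{2s} ≤ ‖u(t)‖₂^{2s−1} ‖u(t)‖_{Ḣ^s}` at every `t ∈ (0, T)`; (K) for every sharp wavenumber `K` and every `M`
  the spectral tail `∫_{‖ξ‖≥K} ‖ξ‖^{2s} ‖û(t)‖²` exceeds `M` on a whole left neighbourhood of `T`;
* `homSobolev_face_of_cascadeWitness` — the same read on the cell's interface (every `CascadeWitness`).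

HONEST SIZE NOTE: constants inexplicit and `s`-dependent, degenerate at both ends of `(1/2, 3/2)`; `s ≥ 3/2` in `Ḣ^s`
not covered; class = `ℝ³` finite energy. Necessity only; nothing about sufficiency. 0 sorry; no new definitions, no
named facts.

## References

* J. C. Robinson, W. Sadowski, Rend. Semin. Mat. Univ. Padova 131 (2014) 159–178, Corollaries 9–10.
  [RobinsonSadowski2014]
* J. C. Robinson, W. Sadowski, R. P. Silva, J. Math. Phys. 53 (2012) 115618. [RobinsonSadowskiSilva2012]
* J. Leray, Acta Math. 63 (1934), §22 p. 227, §34 (6.4) p. 246. [Leray1934]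
-/

noncomputable section

open MeasureTheory SchwartzMap FourierTransform Complex Set Function Filter Topology Metric
open scoped ENNReal NNReal
open Literature.Analysis.FluidPDE Literature.Analysis.FunctionSpaces
open Literature.Analysis.FluidPDE.FluidComputer
open Summit.NavierStokesRegularity.NavierStokesRegularity.Theorems.FluidComputer (x5a_of_cascadeWitness')
open Summit.NavierStokesRegularity.FluidComputer.HomSobolevLadder
open Summit.NavierStokesRegularity.FluidComputer.SobolevLadderSerrin
open Summit.NavierStokesRegularity.FluidComputer.SobolevLadderProduct
open Summit.NavierStokesRegularity.FluidComputer.SpectralFront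

namespace Summit.NavierStokesRegularity.FluidComputer.HomSobolevFace

/-- **THE `Ḣ^s` FACE, ASSEMBLED.** For every `s ∈ (1/2, 3/2)` there are `c, c', c'' > 0` such that for every `ν > 0`,
`T > 0` and every maximal smooth solution `(u, p)` of the unforced Navier–Stokes system on `ℝ³ × [0, T)` which is
Leray–Hopf from `u 0`: (C) `c ν^{(5−2s)/4} (T − t)^{−(2s−1)/4} ≤ ‖u(t)‖_{Ḣ^s}` at every `t ∈ (0, T)` (L52);
(D) `‖u(t)‖_{Ḣ^s} → ∞` as `t ↑ T` (L52′); (S) for all `0 ≤ t₀ ≤ t < T`,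
`c' ν^{(5−2s)/(2s−1)} log((T − t₀)/(T − t)) ≤ ∫⁻_{(t₀,t)} ‖u‖_{Ḣ^s}^{4/(2s−1)}` and for every `t₀ ∈ [0, T)`,
`∫⁻_{(t₀,T)} ‖u‖_{Ḣ^s}^{4/(2s−1)} = ∞` (L52-S); (P) `c'' ν^{2s} ≤ ‖u(t)‖₂^{2s−1} ‖u(t)‖_{Ḣ^s}` at every `t ∈ (0, T)`
(L52-P); (K) for every wavenumber `K` and every `M : ℝ≥0` there is `t₁ < T` with
`M < ∫_{‖ξ‖≥K} ‖ξ‖^{2s} ‖û(t)(ξ)‖² dξ` for all `t ∈ (t₁, T)` and every `L²` witness of the complexified slice (L52⁗).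
[cite: RobinsonSadowski2014, Corollary 10] [cite: RobinsonSadowskiSilva2012, Thm. 1.1]
[cite: Leray1934, §22 p. 227, §34 (6.4) p. 246] -/
theorem homSobolev_face (s : ℝ) (hs : s ∈ Ioo (1 / 2 : ℝ) (3 / 2)) :
    ∃ c c' c'' : ℝ, 0 < c ∧ 0 < c' ∧ 0 < c'' ∧ ∀ (ν T : ℝ), 0 < ν → 0 < T →
      ∀ (u : ℝ → EuclideanSpace ℝ (Fin 3) → EuclideanSpace ℝ (Fin 3)) (p : ℝ → EuclideanSpace ℝ (Fin 3) → ℝ),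
      IsMaximalSmoothSolution ν 0 u p T → IsLerayHopfOn T ν 0 (u 0) u →
      (∀ t ∈ Ioo 0 T,
        ENNReal.ofReal (c * ν ^ ((5 - 2 * s) / 4) * (T - t) ^ (-((2 * s - 1) / 4))) ≤
          Function.eHomSobolevSeminorm s (EuclideanSpace.complexify ∘ u t)) ∧
      Tendsto (fun t => Function.eHomSobolevSeminorm s (EuclideanSpace.complexify ∘ u t)) (𝓝[<] T) (𝓝 ∞) ∧
      (∀ t₀ t : ℝ, 0 ≤ t₀ → t₀ ≤ t → t < T →
        ENNReal.ofReal (c' * ν ^ ((5 - 2 * s) / (2 * s - 1)) * Real.log ((T - t₀) / (T - t))) ≤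
          ∫⁻ τ in Ioo t₀ t,
            Function.eHomSobolevSeminorm s (EuclideanSpace.complexify ∘ u τ) ^ (4 / (2 * s - 1))) ∧
      (∀ t₀ ∈ Ico 0 T,
        ∫⁻ τ in Ioo t₀ T, Function.eHomSobolevSeminorm s (EuclideanSpace.complexify ∘ u τ) ^ (4 / (2 * s - 1)) = ∞) ∧
      (∀ t ∈ Ioo 0 T,
        ENNReal.ofReal (c'' * ν ^ (2 * s)) ≤
          eLpNorm (u t) 2 volume ^ (2 * s - 1) * Function.eHomSobolevSeminorm s (EuclideanSpace.complexify ∘ u t)) ∧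
      ∀ (K : ℝ) (M : ℝ≥0), ∃ t₁ < T, ∀ t ∈ Ioo t₁ T,
        ∀ h2 : MemLp (⇑EuclideanSpace.complexify ∘ u t) 2 volume,
          (M : ℝ≥0∞) < ∫⁻ ξ in (Metric.ball (0 : EuclideanSpace ℝ (Fin 3)) K)ᶜ, ‖ξ‖ₑ ^ (2 * s) *
            ‖((𝓕 (h2.toLp _) : Lp (EuclideanSpace ℂ (Fin 3)) 2 (volume : Measure (EuclideanSpace ℝ (Fin 3)))) :
              EuclideanSpace ℝ (Fin 3) → EuclideanSpace ℂ (Fin 3)) ξ‖ₑ ^ 2 := by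
  obtain ⟨c, hc, HC⟩ := homSobolev_clock s hs
  obtain ⟨c', hc', HS⟩ := homSobolev_log_floor s hs
  obtain ⟨c'', hc'', HP⟩ := homSobolev_energy_product s hs
  refine ⟨c, c', c'', hc, hc', hc'', fun ν T hν hT u p hmax hLH => ⟨HC ν T hν hT u p hmax hLH,
    homSobolev_tendsto_top s hs hν hT hmax hLH, HS ν T hν hT u p hmax hLH,
    fun t₀ ht₀ => homSobolev_lintegral_eq_top s hs hν hT hmax hLH ht₀, HP ν T hν hT u p hmax hLH,
    fun K M => spectral_tail_eventually_gt s hs hν hT hmax hLH K M⟩⟩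

/-- **THE `Ḣ^s` FACE READ ON THE INTERFACE.** Every `W : CascadeWitness` yields `ν > 0`, `T > 0` and a maximal smooth
solution `(u, p)` of the unforced Navier–Stokes system on `ℝ³ × [0, T)`, Leray–Hopf from `u 0` (`x5a_of_cascadeWitness'`),
on which, for EVERY `s ∈ (1/2, 3/2)`: (D) `‖u(t)‖_{Ḣ^s} → ∞` as `t ↑ T`; (S) `∫⁻_{(t₀,T)} ‖u‖_{Ḣ^s}^{4/(2s−1)} = ∞` for
every `t₀ ∈ [0, T)`; (K) every sharp spectral tail of order `s` exceeds every bound on a whole left neighbourhood of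
`T`. (The clock (C) and the product (P) hold too, with the constants of `homSobolev_face`.) Companion of
`SobolevLadderFace.ladder_face_of_cascadeWitness`, `HomSobolevLadder.homSobolev_clock_of_cascadeWitness`.
[cite: RobinsonSadowski2014, Corollary 10] -/
theorem homSobolev_face_of_cascadeWitness (W : CascadeWitness) :
    ∃ ν : ℝ, 0 < ν ∧ ∃ T : ℝ, 0 < T ∧
      ∃ (u : ℝ → EuclideanSpace ℝ (Fin 3) → EuclideanSpace ℝ (Fin 3)) (p : ℝ → EuclideanSpace ℝ (Fin 3) → ℝ),
        IsMaximalSmoothSolution ν 0 u p T ∧ IsLerayHopfOn T ν 0 (u 0) u ∧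
        ∀ s : ℝ, s ∈ Ioo (1 / 2 : ℝ) (3 / 2) →
          Tendsto (fun t => Function.eHomSobolevSeminorm s (EuclideanSpace.complexify ∘ u t)) (𝓝[<] T) (𝓝 ∞) ∧
          (∀ t₀ ∈ Ico 0 T,
            ∫⁻ τ in Ioo t₀ T,
              Function.eHomSobolevSeminorm s (EuclideanSpace.complexify ∘ u τ) ^ (4 / (2 * s - 1)) = ∞) ∧
          ∀ (K : ℝ) (M : ℝ≥0), ∃ t₁ < T, ∀ t ∈ Ioo t₁ T,
            ∀ h2 : MemLp (⇑EuclideanSpace.complexify ∘ u t) 2 volume,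
              (M : ℝ≥0∞) < ∫⁻ ξ in (Metric.ball (0 : EuclideanSpace ℝ (Fin 3)) K)ᶜ, ‖ξ‖ₑ ^ (2 * s) *
                ‖((𝓕 (h2.toLp _) : Lp (EuclideanSpace ℂ (Fin 3)) 2 (volume : Measure (EuclideanSpace ℝ (Fin 3)))) :
                  EuclideanSpace ℝ (Fin 3) → EuclideanSpace ℂ (Fin 3)) ξ‖ₑ ^ 2 := by
  obtain ⟨ν, hν, T, hT, u, p, hmax, hLH, -⟩ := x5a_of_cascadeWitness' W
  refine ⟨ν, hν, T, hT, u, p, hmax, hLH, fun s hs => ⟨homSobolev_tendsto_top s hs hν hT hmax hLH,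
    fun t₀ ht₀ => homSobolev_lintegral_eq_top s hs hν hT hmax hLH ht₀,
    fun K M => spectral_tail_eventually_gt s hs hν hT hmax hLH K M⟩⟩

end Summit.NavierStokesRegularity.FluidComputer.HomSobolevFace

end
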